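import Summits.HubbardSuperconductivity.HubbardSuperconductivity.Theorems.BalabanIRBirEveryGroundStateDarkMeasure
import HarnessLib

/-!
# Crux `BirEveryGroundState` (item `stmt-HubbardSuperconductivity-2083`): reducibly degenerate dark couplings of non-summable measure

Helper file `--supports stmt-HubbardSuperconductivity-2083`
(`Summit.HubbardSuperconductivity.HubbardSuperconductivity.Theses.BalabanIR.BirEveryGroundState`,
crux 5 of route BalabanIR), completing the measure-theoretic normal form of
`…BirEveryGroundStateDarkMeasure` (`tsum_volume_dark_eq_top_of_not_birEveryGroundState`: if the
crux fails, the `c' L⁴`-dark coupling sets have non-summable Lebesgue measure inside every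
sub-window of some window carrying the average bound) in the way
`exists_degenerateInterval_of_not_birEveryGroundState` completes the Baire normal form:

* `tsum_volume_degenerateDark_eq_top_of_not_birEveryGroundState` — after uniformising the average
  bound on a sub-window (`birAvgHyp_uniform_on_dense_subwindow`,
  `le_re_trace_groundProj_mul_of_mem_closure`), the dark sets may be replaced by the sets of
  couplings carrying SIMULTANEOUSLY the trace floor `c L⁴ ≤ re tr (P Δ_d†Δ_d)`, a `c' L⁴`-dark
  normalised ground state (`0 < c' < c`) and a DEGENERATE sector ground eigenspace
  (`dim E₀(U, L) ≥ 2`), and these still have `Σ_{L ≥ L₀ even} |· ∩ (a, b)| = ∞` for every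
  threshold: a counterexample to the crux lives on reducibly degenerate ground multiplets of the
  doped repulsive Hubbard torus occupying, inside every sub-window, coupling sets of infinite
  total length over the sides (while carrying the average order).

Folklore finite-dimensional spectral theory, Baire category and Lebesgue measure; no definitions,
no named facts.
-/

noncomputable section

-- the mandated namespace `Summit.<Summit>.<Problem>.Theorems` repeats `HubbardSuperconductivity`
-- (single-problem summit, D-0017), which the `dupNamespace` linter flags on every declaration
set_option linter.dupNamespace false

namespace Summit.HubbardSuperconductivity.HubbardSuperconductivity.Theorems

open Matrix Set Filter Topology MeasureTheory
open Literature.Probability.LatticeModels Literature.MathematicalPhysics.QuantumLattice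
open Summit.HubbardSuperconductivity.HubbardSuperconductivity.Theses.BalabanIR
open scoped ComplexOrder ENNReal

/-! ### Consequence: reducibly degenerate dark couplings of non-summable measure -/

/-- **`¬ BirEveryGroundState` forces DEGENERATE dark ground multiplets on coupling sets of
non-summable measure.** If the crux fails, there are `δ ∈ (0, ½)`, a repulsive window
`0 < U₁ < U₂` and `c > 0` with the crux's window-average hypothesis on `(U₁, U₂)` such that every
non-trivial sub-window `(a', b')` contains a non-trivial window `(a, b)` on which, for every
darkness constant `0 < c' < c` and every threshold `L₀`, the sets of couplings `U ∈ (a, b)`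
carrying at side `L` SIMULTANEOUSLY (i) the trace floor `c L⁴ ≤ re tr (P Δ_d†Δ_d)` on the
`(2⌊(1-δ)L²/2⌋, S^z = 0)`-sector ground eigenspace `E₀(U, L)` of `hubbardTorus 2 L 1 U` (`P` its
orthogonal projection), (ii) a `c' L⁴`-dark normalised sector ground state, and (iii)
`dim E₀(U, L) ≥ 2`, have `Σ_{L ≥ L₀ even, L ≠ 0} |·| = ∞`. Proof: Baire makes the average bound
uniform (`L ≥ L₁`) on a dense subset of a window `(a, b) ⊆ (a', b')`
(`birAvgHyp_uniform_on_dense_subwindow`), whence the trace floor at EVERY coupling of `(a, b)`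
(`le_re_trace_groundProj_mul_of_mem_closure`); so beyond `max L₀ L₁` every `c' L⁴`-dark coupling
of `(a, b)` carries (i) and (ii), and (iii) because on a line the compression of `Δ_d†Δ_d` is the
scalar `re tr (P Δ_d†Δ_d) ≥ c L⁴ > c' L⁴` (`UniqueGround.exists_scalar_of_finrank_one`,
`UniqueGround.le_re_of_scalar_of_average`); the dark sets beyond `max L₀ L₁` already have
infinite total measure in `(a, b)` (`tsum_volume_dark_eq_top_of_not_birEveryGroundState`). So a
counterexample to the crux lives on reducibly degenerate ground multiplets of the doped repulsive
Hubbard torus occupying, inside every sub-window, coupling sets of infinite total length over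
the sides. Kato (1966) II-§5.1; Baire (1899); Lebesgue (1902). [folklore] -/
theorem tsum_volume_degenerateDark_eq_top_of_not_birEveryGroundState (hS : ¬ BirEveryGroundState) :
    ∃ (δ U₁ U₂ c : ℝ), δ ∈ Set.Ioo (0:ℝ) (1/2) ∧ 0 < U₁ ∧ U₁ < U₂ ∧ 0 < c ∧
      (∀ U ∈ Set.Ioo U₁ U₂, ∃ L₀ : ℕ, ∀ (L : ℕ) [NeZero L], L₀ ≤ L → Even L →
        let N : ℕ := 2 * ⌊(1 - δ) * (L : ℝ) ^ 2 / 2⌋₊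
        let H := hubbardTorus 2 L 1 U
        let S := szSector (Λ := FermionTorus 2 L) N 0
        let E₀ := S ⊓ Module.End.eigenspace (Matrix.toLin' H) ((H.minEnergyOn S : ℝ) : ℂ)
        let P := projMatrix (E₀.map (Fock.toEuclidean (ι := Orb (FermionTorus 2 L)) :
          Fock (Orb (FermionTorus 2 L)) →ₗ[ℂ] EuclideanSpace ℂ (Finset (Orb (FermionTorus 2 L)))))
        c * (L : ℝ) ^ 4 * P.trace.re ≤
          (P * ((pairField dWaveFormFactor L)ᴴ * pairField dWaveFormFactor L)).trace.re) ∧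
      ∀ a' b' : ℝ, U₁ ≤ a' → a' < b' → b' ≤ U₂ → ∃ a b : ℝ, a' ≤ a ∧ a < b ∧ b ≤ b' ∧
        ∀ c' : ℝ, 0 < c' → c' < c → ∀ L₀ : ℕ,
          ∑' L : ℕ, volume (Set.Ioo a b ∩ {U : ℝ | ∃ (_ : NeZero L), L₀ ≤ L ∧ Even L ∧
            (let N : ℕ := 2 * ⌊(1 - δ) * (L : ℝ) ^ 2 / 2⌋₊
            let H := hubbardTorus 2 L 1 U
            let S := szSector (Λ := FermionTorus 2 L) N 0
            let E₀ := S ⊓ Module.End.eigenspace (Matrix.toLin' H) ((H.minEnergyOn S : ℝ) : ℂ)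
            let P := projMatrix (E₀.map (Fock.toEuclidean (ι := Orb (FermionTorus 2 L)) :
              Fock (Orb (FermionTorus 2 L)) →ₗ[ℂ]
                EuclideanSpace ℂ (Finset (Orb (FermionTorus 2 L)))))
            c * (L : ℝ) ^ 4 ≤
                (P * ((pairField dWaveFormFactor L)ᴴ * pairField dWaveFormFactor L)).trace.re ∧
              (∃ ψ : Fock (Orb (FermionTorus 2 L)), IsGroundStateInSector H N 0 ψ ∧
                star ψ ⬝ᵥ ψ = 1 ∧
                (star ψ ⬝ᵥ ((pairField dWaveFormFactor L)ᴴ * pairField dWaveFormFactor L) *ᵥ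
                  ψ).re ≤ c' * (L : ℝ) ^ 4) ∧
              2 ≤ Module.finrank ℂ ↥E₀)}) = ⊤ := by
  classical
  obtain ⟨δ, U₁, U₂, c, hδ, hU₁, hU₁₂, hc, hyp, hdark⟩ :=
    tsum_volume_dark_eq_top_of_not_birEveryGroundState hS
  refine ⟨δ, U₁, U₂, c, hδ, hU₁, hU₁₂, hc, hyp, fun a' b' ha' hab' hb' => ?_⟩
  -- Baire: one threshold `L₁` for the average bound on a dense subset of a sub-window `(a, b)`
  -- of `(a', b')` (the average bound holds on `(a', b') ⊆ (U₁, U₂)`)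
  have hyp' : ∀ U ∈ Set.Ioo a' b', ∃ L₀ : ℕ, ∀ (L : ℕ) [NeZero L], L₀ ≤ L → Even L →
      let N : ℕ := 2 * ⌊(1 - δ) * (L : ℝ) ^ 2 / 2⌋₊
      let H := hubbardTorus 2 L 1 U
      let S := szSector (Λ := FermionTorus 2 L) N 0
      let E₀ := S ⊓ Module.End.eigenspace (Matrix.toLin' H) ((H.minEnergyOn S : ℝ) : ℂ)
      let P := projMatrix (E₀.map (Fock.toEuclidean (ι := Orb (FermionTorus 2 L)) :
        Fock (Orb (FermionTorus 2 L)) →ₗ[ℂ] EuclideanSpace ℂ (Finset (Orb (FermionTorus 2 L)))))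
      c * (L : ℝ) ^ 4 * P.trace.re ≤
        (P * ((pairField dWaveFormFactor L)ᴴ * pairField dWaveFormFactor L)).trace.re :=
    fun U hU => hyp U ⟨lt_of_le_of_lt ha' hU.1, lt_of_lt_of_le hU.2 hb'⟩
  obtain ⟨L₁, a, b, ha, hab, hb, hsub⟩ := birAvgHyp_uniform_on_dense_subwindow hab' hyp'
  refine ⟨a, b, ha.le, hab, hb.le, fun c' hc' hc'c L₀ => ?_⟩
  -- the `c' L⁴`-dark sets beyond `max L₀ L₁` have infinite total measure in `(a, b)` …
  have htop := hdark a b c' (ha'.trans ha.le) hab (hb.le.trans hb') hc' (max L₀ L₁)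
  -- … and are contained in the degenerate-dark sets beyond `L₀`
  rw [eq_top_iff, ← htop]
  refine ENNReal.tsum_le_tsum fun L => measure_mono fun U hU => ?_
  obtain ⟨hUab, hLne, hLmax, hE, ψ, hgs, hψ1, hψdark⟩ := hU
  haveI : NeZero L := hLne
  refine ⟨hUab, hLne, le_of_max_le_left hLmax, hE, ?_⟩
  dsimp only
  have hLL₁ : L₁ ≤ L := le_of_max_le_right hLmax
  -- the objects of side `L`
  set B : Matrix (Finset (Orb (FermionTorus 2 L))) (Finset (Orb (FermionTorus 2 L))) ℂ :=
    (pairField dWaveFormFactor L)ᴴ * pairField dWaveFormFactor L with hB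
  set S : Submodule ℂ (Fock (Orb (FermionTorus 2 L))) :=
    szSector (Λ := FermionTorus 2 L) (2 * ⌊(1 - δ) * (L : ℝ) ^ 2 / 2⌋₊) 0 with hS_def
  set D : Matrix (Finset (Orb (FermionTorus 2 L))) (Finset (Orb (FermionTorus 2 L))) ℂ :=
    ∑ x : FermionTorus 2 L, numberOp x 0 * numberOp x 1 with hD
  -- the pencil `hubbardTorus 2 L 1 w = H(0) + w • D`, Hermitian, preserving `S ≠ ⊥`; `B ≥ 0`
  have hpen : ∀ w : ℝ, hubbardTorus 2 L 1 w = hubbardTorus 2 L 1 0 + (w : ℂ) • D := fun w =>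
    hubbardTorus_eq_zero_add_smul_interaction w
  have hHh : ∀ w : ℝ, (hubbardTorus 2 L 1 w).IsHermitian := fun w =>
    hubbardTorus_isHermitian (hamiltonian_isHermitian_and_commute_holds (fermionTorusGraph 2 L))
      1 w
  have hDeq : D = hubbardTorus 2 L 1 1 - hubbardTorus 2 L 1 0 := by
    rw [hpen 1, Complex.ofReal_one, one_smul, add_sub_cancel_left]
  have hDh : D.IsHermitian := by rw [hDeq]; exact (hHh 1).sub (hHh 0)
  have hSH : ∀ w ∈ S, hubbardTorus 2 L 1 0 *ᵥ w ∈ S := fun w hw =>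
    hubbardTorus_mulVec_mem_szSector 1 0 hw
  have hSD : ∀ w ∈ S, D *ᵥ w ∈ S := fun w hw => by
    rw [hDeq, sub_mulVec]
    exact S.sub_mem (hubbardTorus_mulVec_mem_szSector 1 1 hw)
      (hubbardTorus_mulVec_mem_szSector 1 0 hw)
  have hBpsd : B.PosSemidef := Matrix.posSemidef_conjTranspose_mul_self _
  -- the dark unit ground state `ψ` at `U` lies in the ground eigenspace
  set E₀ : Submodule ℂ (Fock (Orb (FermionTorus 2 L))) :=
    S ⊓ Module.End.eigenspace (Matrix.toLin' (hubbardTorus 2 L 1 U))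
      (((hubbardTorus 2 L 1 U).minEnergyOn S : ℝ) : ℂ) with hE₀
  have hψE : ψ ∈ E₀ := by
    refine Submodule.mem_inf.mpr ⟨hgs.1, ?_⟩
    rw [Module.End.mem_eigenspace_iff, Matrix.toLin'_apply]
    exact hgs.2.2
  have hSne : S ≠ ⊥ := fun h => hgs.2.1 ((Submodule.eq_bot_iff _).1 h ψ hgs.1)
  -- `U` lies in the closure of the couplings where the average bound holds for all `L ≥ L₁`
  have hcl := hsub hUab
  -- (i) the trace floor `c L⁴ ≤ re tr (P(U) B)` (upper semicontinuity of the ground multiplet)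
  have hfloor : c * (L : ℝ) ^ 4 ≤ (projMatrix (E₀.map
      ((WithLp.linearEquiv 2 ℂ (Finset (Orb (FermionTorus 2 L)) → ℂ)).symm :
        (Finset (Orb (FermionTorus 2 L)) → ℂ) →ₗ[ℂ]
          EuclideanSpace ℂ (Finset (Orb (FermionTorus 2 L))))) * B).trace.re := by
    refine le_re_trace_groundProj_mul_of_mem_closure (hHh 0) hDh hBpsd S hSH hSD hSne
      (A := fun w => hubbardTorus 2 L 1 w)
      (E := fun w => S ⊓ Module.End.eigenspace (Matrix.toLin' (hubbardTorus 2 L 1 w))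
        (((hubbardTorus 2 L 1 w).minEnergyOn S : ℝ) : ℂ))
      (P := fun w => projMatrix ((S ⊓ Module.End.eigenspace
        (Matrix.toLin' (hubbardTorus 2 L 1 w))
          (((hubbardTorus 2 L 1 w).minEnergyOn S : ℝ) : ℂ)).map
        ((WithLp.linearEquiv 2 ℂ (Finset (Orb (FermionTorus 2 L)) → ℂ)).symm :
          (Finset (Orb (FermionTorus 2 L)) → ℂ) →ₗ[ℂ]
            EuclideanSpace ℂ (Finset (Orb (FermionTorus 2 L))))))
      hpen (fun _ => rfl) (fun _ => rfl) hcl fun w hw => ?_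
    exact hw.2 L hLL₁ hE
  refine ⟨hfloor, ⟨ψ, hgs, hψ1, hψdark⟩, ?_⟩
  -- (iii) if `E₀` were a line, the compression of `B` would be the scalar `re tr (P B) ≥ c L⁴` …
  by_contra hlt
  have hE₀ne : E₀ ≠ ⊥ := fun h => hgs.2.1 ((Submodule.eq_bot_iff _).1 h ψ hψE)
  have hfin : Module.finrank ℂ E₀ = 1 :=
    le_antisymm (by omega) (Submodule.one_le_finrank_iff.mpr hE₀ne)
  have htr : (projMatrix (E₀.map
      ((WithLp.linearEquiv 2 ℂ (Finset (Orb (FermionTorus 2 L)) → ℂ)).symm :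
        (Finset (Orb (FermionTorus 2 L)) → ℂ) →ₗ[ℂ]
          EuclideanSpace ℂ (Finset (Orb (FermionTorus 2 L)))))).trace.re = 1 := by
    rw [re_trace_projMatrix_map_eq_finrank, hfin, Nat.cast_one]
  have havg : c * (L : ℝ) ^ 4 * (projMatrix (E₀.map
      ((WithLp.linearEquiv 2 ℂ (Finset (Orb (FermionTorus 2 L)) → ℂ)).symm :
        (Finset (Orb (FermionTorus 2 L)) → ℂ) →ₗ[ℂ]
          EuclideanSpace ℂ (Finset (Orb (FermionTorus 2 L)))))).trace.re ≤
      (projMatrix (E₀.map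
      ((WithLp.linearEquiv 2 ℂ (Finset (Orb (FermionTorus 2 L)) → ℂ)).symm :
        (Finset (Orb (FermionTorus 2 L)) → ℂ) →ₗ[ℂ]
          EuclideanSpace ℂ (Finset (Orb (FermionTorus 2 L))))) * B).trace.re := by
    rw [htr, mul_one]; exact hfloor
  -- … so the dark direction `ψ` would have `c L⁴ ≤ re ⟨ψ, B ψ⟩ ≤ c' L⁴ < c L⁴`: contradiction
  have hge : c * (L : ℝ) ^ 4 ≤ (star ψ ⬝ᵥ B *ᵥ ψ).re :=
    UniqueGround.le_re_of_scalar_of_average E₀ B _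
      (UniqueGround.exists_scalar_of_finrank_one E₀ hfin B) havg hψE hψ1
  have hL4 : (0 : ℝ) < (L : ℝ) ^ 4 := by
    have hL0 : (0 : ℝ) < (L : ℝ) := Nat.cast_pos.2 (Nat.pos_of_ne_zero (NeZero.ne L))
    positivity
  nlinarith [hge.trans hψdark]

end Summit.HubbardSuperconductivity.HubbardSuperconductivity.Theorems
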